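import Literature.Barriers.QuantumFields.ScalarPhi4Triviality
import Literature.MathematicalPhysics.QuantumFieldTheory.ContinuumLimitsTrivialityPrintedInputProofs
import Literature.MathematicalPhysics.QuantumFieldTheory.ContinuumLimitsPhi4WickProofs
import HarnessLib

/-!
# Barrier `ScalarPhi4Triviality`: reduction to the printed Prop. 7.2 of Aizenman–Duminil-Copin (proofs)

Sibling proofs file of `Literature/Barriers/QuantumFields/ScalarPhi4Triviality.lean` (barrier
catalogue `Literature/Barriers/QuantumFields/`, D-0021; summit `QuantumFields`). Theorems only:
the barrier declaration `ScalarPhi4Triviality` (a definitional alias of the tree fact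
`Literature.MathematicalPhysics.QuantumFieldTheory.phi44_triviality`, ADC 2021 Thm 1.2 for lattice
`φ⁴₄`) and its technique class `IsPhi44LatticeScalingLimit` are unchanged; no definition and no
named fact is introduced (D-0026).

* `scalarPhi4Triviality_of_prop72` — the barrier holds as soon as the two printed inputs of
  Aizenman–Duminil-Copin's deduction of Thm 1.2 hold for the free-boundary infinite-volume
  lattice `φ⁴₄` state: Prop. 7.2 (p. 28, Griffiths–Simon class ⊇ lattice `φ⁴`, in the form its
  proof §6.3 gives) and the two-sided variance bound of p. 6 — through
  `Literature.MathematicalPhysics.QuantumFieldTheory.phi44_triviality_of_prop72`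
  (`ContinuumLimitsTrivialityPrintedInputProofs`: identification of the thermodynamic limits in
  law with the box limits, dilation to the printed window `L ≤ ξ`, and the law-level assembly
  `phi44_triviality_of_scaleBound`).
* `isGaussianField_of_isPhi44LatticeScalingLimit_of_prop72` — the same over the technique class:
  under the two printed inputs, every law reachable by the lattice `φ⁴₄` construction is a centred
  Gaussian field.

* (Ising clause of the barrier's `blocks:` line.) The tree fact
  `Literature.MathematicalPhysics.QuantumFieldTheory.ising4_triviality` (ADC Thm 1.2 with §1.3)
  reduces to ADC Theorem 1.3 alone
  (`Literature.Probability.LatticeModels.aizenmanDuminilCopin_improvedTreeDiagramBound`):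
  `Literature.MathematicalPhysics.QuantumFieldTheory.ising4_triviality_of_improvedTreeDiagramBound`
  (`ContinuumLimitsTrivialityReductionsProofs`, on top of the crit-ising law-level theorem
  `isGaussianField_of_tendstoInLaw_spinFieldLaw_gibbs`); not restated here.

* `scalarPhi4Triviality_of_ursellFourSum` — (added 2026-08-15, session 3) the barrier from the
  printed `U₄` smallness ALONE: the summation layer of ADC §6.3 for lattice `φ⁴`
  (`ContinuumLimitsPhi4WickProofs`), Aizenman's Prop. 12.1 for the `φ⁴` box states
  (`QuantumLattice/Phi4WickDeviation`) and the two-point doubling (`QuantumLattice/Phi4TwoPointDoubling`)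
  are theorems of the tree, so `ScalarPhi4Triviality` follows from ADC Prop. 7.2 / Thm 7.1 (+ §5) in the
  form `∑_{Λ_{rL}⁴} |U₄^R| ≤ ε(L) r^k (∑_{Λ_L²} S₂^R)²`, `ε(L) → 0`, in the window `L ξ⁻¹ ≤ 1`
  (`Literature.MathematicalPhysics.QuantumFieldTheory.phi44_triviality_of_ursellFourSum`).

What is NOT here: Prop. 7.2 / Thm 7.1 for lattice `φ⁴` (the `φ⁴₄` substance of the source), nor ADC
Thm 1.3, hence neither `ScalarPhi4Triviality_holds` nor `ising4_triviality_holds`; the `d ≥ 5` clause (`phi4_highDim_triviality`) is reduced to Panis 2023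
Thm 5.5 in `ContinuumLimitsTrivialityReductionsProofs` (`phi4_highDim_triviality_of_thm55`).

## References

* M. Aizenman, H. Duminil-Copin, *Marginal triviality of the scaling limits of critical 4D Ising
  and `φ⁴₄` models*, Ann. Math. 194 (2021) 163–235, arXiv:1912.07973: Thm 1.2 (p. 4), Prop. 7.2
  (p. 28), p. 6 (display after Prop. 1.4), §5 (p. 16) [AizenmanDuminilCopinAnnals2021].
-/

noncomputable section

open scoped SchwartzMap
open MeasureTheory Filter Topology
open Literature.MathematicalPhysics.QuantumLattice (FieldConfig IsGaussianField phi4CriticalJ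
  phi4TwoPoint)
open Literature.MathematicalPhysics.QuantumFieldTheory (phi4BoxExpect phi4NormalizedField
  phi44_triviality_of_prop72)
open Literature.Probability.LatticeModels (HasBoxLimit invCorrLength)

namespace Literature.Barriers.QuantumFields

/-- **The barrier from the printed inputs** (Aizenman–Duminil-Copin 2021: Thm 1.2 from Prop. 7.2
and the p. 6 variance bounds). If, for the free-boundary infinite-volume lattice `φ⁴₄` state
(box limits `HasBoxLimit (phi4BoxExpect 4 g κ J ·)`) and the normalised field
`T_{f,L} = Σ_L^{-1/2} ∑_x f(x/L) φ_x` (`phi4NormalizedField`), (`h72`) Prop. 7.2 holds in the form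
its proof establishes — for `g > 0`, `κ`, constants `c, C > 0`, all `0 ≤ J ≤ J_c` in the window
`J = J_c ∨ (0 < J ∧ L ξ(J)⁻¹ ≤ 1)`, `L > 1`, `r ≥ 1`, continuous `f` vanishing outside `[-r,r]⁴`,
real `z`: the limits `⟨e^{zT_{f,L}}⟩`, `⟨T²_{f,L}⟩`, `⟨T²_{|f|,L}⟩` exist and
`|⟨e^{zT}⟩ - e^{z²⟨T²⟩/2}| ≤ e^{z²⟨T²_{|f|}⟩/2} C ‖f‖_∞⁴ r¹² z⁴/(log L)^c` — and (`hvar`) the p. 6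
bounds `c_f ≤ ⟨T²_{f,L}⟩ ≤ C_f` hold, then `ScalarPhi4Triviality`: no non-Gaussian `d = 4` field
is reachable by the lattice `φ⁴₄` construction. (Alias of `phi44_triviality_of_prop72`.)
[cite: AizenmanDuminilCopinAnnals2021, Thm 1.2 (p. 4), Prop. 7.2 (p. 28), p. 6] -/
theorem scalarPhi4Triviality_of_prop72
    (h72 : ∀ (g κ : ℝ), 0 < g → ∃ c C : ℝ, 0 < c ∧ 0 < C ∧
      ∀ (J L r : ℝ), 0 ≤ J → J ≤ phi4CriticalJ 4 g κ →
        (J = phi4CriticalJ 4 g κ ∨ (0 < J ∧ L * invCorrLength (phi4TwoPoint 4 g κ J) ≤ 1)) →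
        1 < L → 1 ≤ r →
      ∀ f : EuclideanSpace ℝ (Fin 4) → ℝ, Continuous f → (∀ x, f x ≠ 0 → ∀ i, |x i| ≤ r) →
      ∀ z : ℝ, ∃ m v v' : ℝ,
        HasBoxLimit (phi4BoxExpect 4 g κ J fun φ =>
          Real.exp (z * phi4NormalizedField 4 g κ J L f φ)) m ∧
        HasBoxLimit (phi4BoxExpect 4 g κ J fun φ => phi4NormalizedField 4 g κ J L f φ ^ 2) v ∧
        HasBoxLimit (phi4BoxExpect 4 g κ J fun φ =>
          phi4NormalizedField 4 g κ J L (fun x => |f x|) φ ^ 2) v' ∧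
        |m - Real.exp (z ^ 2 / 2 * v)| ≤
          Real.exp (z ^ 2 / 2 * v') * (C * (⨆ x, |f x|) ^ 4 * r ^ 12 * z ^ 4 / Real.log L ^ c))
    (hvar : ∀ (g κ : ℝ), 0 < g → ∀ f : EuclideanSpace ℝ (Fin 4) → ℝ, Continuous f →
      HasCompactSupport f →
      (∃ C : ℝ, ∀ (J L : ℝ), 0 ≤ J → J ≤ phi4CriticalJ 4 g κ → 1 ≤ L →
        ∃ v : ℝ, HasBoxLimit (phi4BoxExpect 4 g κ J fun φ =>
          phi4NormalizedField 4 g κ J L f φ ^ 2) v ∧ v ≤ C) ∧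
      ((∀ x, 0 ≤ f x) → f ≠ 0 → ∃ c L₀ : ℝ, 0 < c ∧
        ∀ (J L : ℝ), 0 ≤ J → J ≤ phi4CriticalJ 4 g κ → L₀ ≤ L →
        ∃ v : ℝ, HasBoxLimit (phi4BoxExpect 4 g κ J fun φ =>
          phi4NormalizedField 4 g κ J L f φ ^ 2) v ∧ c ≤ v)) :
    ScalarPhi4Triviality :=
  scalarPhi4Triviality_iff.2 (phi44_triviality_of_prop72 h72 hvar)

/-- **The barrier over its technique class, from the printed inputs**: under Prop. 7.2 (proof
form) and the p. 6 variance bounds for the free-boundary infinite-volume lattice `φ⁴₄` state,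
every law `μ` on `𝒮'(ℝ⁴)` reachable by the lattice `φ⁴₄` construction
(`IsPhi44LatticeScalingLimit μ`) is a centred Gaussian field.
[cite: AizenmanDuminilCopinAnnals2021, Thm 1.2 (p. 4), Prop. 7.2 (p. 28), p. 6] -/
theorem isGaussianField_of_isPhi44LatticeScalingLimit_of_prop72
    (h72 : ∀ (g κ : ℝ), 0 < g → ∃ c C : ℝ, 0 < c ∧ 0 < C ∧
      ∀ (J L r : ℝ), 0 ≤ J → J ≤ phi4CriticalJ 4 g κ →
        (J = phi4CriticalJ 4 g κ ∨ (0 < J ∧ L * invCorrLength (phi4TwoPoint 4 g κ J) ≤ 1)) →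
        1 < L → 1 ≤ r →
      ∀ f : EuclideanSpace ℝ (Fin 4) → ℝ, Continuous f → (∀ x, f x ≠ 0 → ∀ i, |x i| ≤ r) →
      ∀ z : ℝ, ∃ m v v' : ℝ,
        HasBoxLimit (phi4BoxExpect 4 g κ J fun φ =>
          Real.exp (z * phi4NormalizedField 4 g κ J L f φ)) m ∧
        HasBoxLimit (phi4BoxExpect 4 g κ J fun φ => phi4NormalizedField 4 g κ J L f φ ^ 2) v ∧
        HasBoxLimit (phi4BoxExpect 4 g κ J fun φ =>
          phi4NormalizedField 4 g κ J L (fun x => |f x|) φ ^ 2) v' ∧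
        |m - Real.exp (z ^ 2 / 2 * v)| ≤
          Real.exp (z ^ 2 / 2 * v') * (C * (⨆ x, |f x|) ^ 4 * r ^ 12 * z ^ 4 / Real.log L ^ c))
    (hvar : ∀ (g κ : ℝ), 0 < g → ∀ f : EuclideanSpace ℝ (Fin 4) → ℝ, Continuous f →
      HasCompactSupport f →
      (∃ C : ℝ, ∀ (J L : ℝ), 0 ≤ J → J ≤ phi4CriticalJ 4 g κ → 1 ≤ L →
        ∃ v : ℝ, HasBoxLimit (phi4BoxExpect 4 g κ J fun φ =>
          phi4NormalizedField 4 g κ J L f φ ^ 2) v ∧ v ≤ C) ∧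
      ((∀ x, 0 ≤ f x) → f ≠ 0 → ∃ c L₀ : ℝ, 0 < c ∧
        ∀ (J L : ℝ), 0 ≤ J → J ≤ phi4CriticalJ 4 g κ → L₀ ≤ L →
        ∃ v : ℝ, HasBoxLimit (phi4BoxExpect 4 g κ J fun φ =>
          phi4NormalizedField 4 g κ J L f φ ^ 2) v ∧ c ≤ v))
    {μ : Measure (FieldConfig (EuclideanSpace ℝ (Fin 4)))} (hμ : IsPhi44LatticeScalingLimit μ) :
    IsGaussianField μ :=
  scalarPhi4Triviality_iff_forall.1 (scalarPhi4Triviality_of_prop72 h72 hvar) μ hμ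

/-- **The barrier from the printed `U₄` smallness alone** (Aizenman–Duminil-Copin 2021: Thm 1.2 for
lattice `φ⁴₄` reduced to its core estimate, Prop. 7.2 via Thm 7.1 and §5). Everything else in the
deduction — Aizenman's Wick sandwich (Prop. 12.1) for the `φ⁴` box states, the summation over `n`,
the thermodynamic limit along the convergence in law, the two-point doubling and the scaling-window
bookkeeping — is proved in the tree (`phi44_triviality_of_ursellFourSum`,
`ContinuumLimitsPhi4WickProofs`). Hypothesis: for `g > 0`, `κ` there are `k` and `ε(L) → 0` such that
for `0 ≤ J ≤ J_c` in the window `J = J_c ∨ (0 < J ∧ L ξ(J)⁻¹ ≤ 1)`, `L, r ≥ 1`, eventually in the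
volume `R`, `∑_{u ∈ Λ_{rL}⁴} |U₄^R(u)| ≤ ε(L) r^k (∑_{x,y ∈ Λ_L} ⟨φ_xφ_y⟩_R)²`. [cite: AizenmanDuminilCopinAnnals2021, Thm 1.2 (p. 4), §6.3 (p. 26), Thm 7.1 / Prop. 7.2 (p. 28), §5 (pp. 16–20)] -/
theorem scalarPhi4Triviality_of_ursellFourSum
    (hU : ∀ (g κ : ℝ), 0 < g → ∃ (k : ℕ) (ε : ℝ → ℝ), Tendsto ε atTop (𝓝 0) ∧
      ∀ J L r : ℝ, 0 ≤ J → J ≤ phi4CriticalJ 4 g κ →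
        (J = phi4CriticalJ 4 g κ ∨ (0 < J ∧ L * invCorrLength (phi4TwoPoint 4 g κ J) ≤ 1)) →
        1 ≤ L → 1 ≤ r → ∀ᶠ R : ℕ in atTop,
          ∑ u ∈ Fintype.piFinset (fun _ : Fin 4 =>
              Literature.Probability.LatticeModels.latticeBox 4 (r * L)),
              |Literature.Probability.LatticeModels.connectedFour
                (Literature.MathematicalPhysics.QuantumLattice.phi4BoxMeasure 4 R g κ J)
                (fun (z : Literature.Probability.LatticeModels.Site 4)
                  (φ : Literature.Probability.LatticeModels.Site 4 → ℝ) => φ z) u| ≤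
            ε L * r ^ k *
              (∑ x ∈ Literature.Probability.LatticeModels.latticeBox 4 L,
                ∑ y ∈ Literature.Probability.LatticeModels.latticeBox 4 L,
                  Literature.MathematicalPhysics.QuantumLattice.phi4TwoPointBox 4 R g κ J x y) ^ 2) :
    ScalarPhi4Triviality :=
  scalarPhi4Triviality_iff.2
    (Literature.MathematicalPhysics.QuantumFieldTheory.phi44_triviality_of_ursellFourSum hU)

end Literature.Barriers.QuantumFields

end
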